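import Literature.MathematicalPhysics.QuantumLattice.HeatKernelGroupConvolutionProofs
import Mathlib.MeasureTheory.Integral.Pi
import HarnessLib

/-!
# Planar lattice `YM₂`, layer 1: the law of an ordered product of independent plaquette variables

First layer of the lattice half of Driver's lattice-to-continuum theorem for two-dimensional
Yang–Mills (B. K. Driver, *YM₂: continuum expectations, lattice convergence, and lassos*, CMP
**123** (1989) 575–616, §7: Thm 7.4/7.5 — under the planar lattice measure with a normalised
class-function plaquette weight `A`, the holonomies of the faces of a planar graph are independent
with densities `A_{|R|} = A^{⋆|R|}`, the `|R|`-fold convolution power), supporting the `S27`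
conjuncts of `ContinuumLimits.lean` (`ym2_exists_heatKernel`, `ym2_exists_wilson_of_injective`,
`ym2_exists_wilson`).

This file is purely group-theoretic: for a compact (second countable) group `G` with its Haar
probability measure `dg` and a continuous weight `φ : G → ℝ`,

* `integral_pi_ofFn_prod_mul_prod`: for `k + 1` independent `G`-valued variables
  `w₀, …, w_k`, each with "density" `φ`, and every bounded measurable `F : G → ℝ`,
  `∫ F(w₀ w₁ ⋯ w_k) ∏ᵢ φ(wᵢ) dw = ∫ F(g) φ^{⋆(k+1)}(g) dg`, where the convolution power is written
  with the tree's `haarConv` (`(φ ⋆ ψ)(x) = ∫ φ(h) ψ(h⁻¹x) dh`, `HeatKernelGroupConvolutionProofs`)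
  as the iterate `(haarConv φ)^[k] φ` — Driver's splicing formula (proof of Thm 7.4, p. 600) /
  the definition of `A_n` (Def 7.1);
* `IsGroupHeatKernel.haarConv_iterate_eq`: for a heat kernel, `p_t^{⋆(k+1)} = p_{(k+1)t}`
  (Chapman–Kolmogorov), whence `integral_pi_ofFn_prod_mul_prod_heatKernel`: the same integral with
  `φ = p_t` equals the Driver–Sengupta loop value `ym2LoopValue F p ((k+1) t)`.

Everything is proved; no definitions and no named facts are introduced (the convolution power is
the iterate `(haarConv φ)^[k] φ`, i.e. `φ^{⋆(k+1)}`).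

## References

* B. K. Driver, CMP **123** (1989) 575–616, Def 7.1 (`A_n`), Thm 7.4 and its proof (splicing
  formula, p. 600), Thm 7.5. [DriverCMP1989]
* T. Lévy, *Two-dimensional Markovian holonomy fields*, Astérisque **329** (2010), §4.1
  (convolution semigroups on compact groups). [Levy2010]
-/

open MeasureTheory Filter Topology
open Literature.MathematicalPhysics.QuantumLattice

noncomputable section

namespace Literature.MathematicalPhysics.QuantumFieldTheory

variable {G : Type*} [Group G] [TopologicalSpace G] [IsTopologicalGroup G] [CompactSpace G]
  [MeasurableSpace G] [BorelSpace G]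

/-! ### Convolution powers `φ^{⋆(k+1)} = (haarConv φ)^[k] φ` -/

/-- The convolution powers `φ^{⋆(k+1)} = (haarConv φ)^[k] φ` of a continuous function on a compact
group are continuous (Driver 1989, Def 7.1: `A_n` is again an action function). [cite: DriverCMP1989, Def 7.1] -/
theorem continuous_haarConv_iterate {φ : G → ℝ} (hφ : Continuous φ) :
    ∀ k : ℕ, Continuous ((haarConv φ)^[k] φ)
  | 0 => hφ
  | k + 1 => by
    rw [Function.iterate_succ_apply']
    exact continuous_haarConv hφ
      (((continuous_haarConv_iterate hφ k).integrable_of_hasCompactSupport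
        (HasCompactSupport.of_compactSpace _)))

/-- The convolution powers of a non-negative function are non-negative. [cite: DriverCMP1989, Def 7.1] -/
theorem haarConv_iterate_nonneg {φ : G → ℝ} (hφ : ∀ g, 0 ≤ φ g) :
    ∀ (k : ℕ) (g : G), 0 ≤ ((haarConv φ)^[k] φ) g
  | 0, g => hφ g
  | k + 1, g => by
    rw [Function.iterate_succ_apply', haarConv_apply]
    exact integral_nonneg fun h => mul_nonneg (hφ h) (haarConv_iterate_nonneg hφ k _)

/-- The convolution powers of a normalised weight are normalised: `∫ φ = 1 ⇒ ∫ φ^{⋆(k+1)} = 1`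
(Driver 1989, Def 7.1; Fubini and left invariance). [cite: DriverCMP1989, Def 7.1] -/
theorem integral_haarConv_iterate [SecondCountableTopology G] {φ : G → ℝ} (hφ : Continuous φ)
    (hφ1 : ∫ g, φ g ∂(haarProbability G) = 1) :
    ∀ k : ℕ, ∫ g, ((haarConv φ)^[k] φ) g ∂(haarProbability G) = 1
  | 0 => hφ1
  | k + 1 => by
    set ψ := (haarConv φ)^[k] φ with hψdef
    have hψ : Continuous ψ := continuous_haarConv_iterate hφ k
    rw [Function.iterate_succ_apply', ← hψdef]
    simp only [haarConv_apply]
    -- Fubini: `∫∫ φ(h) ψ(h⁻¹ g) dh dg = ∫ φ(h) (∫ ψ(h⁻¹ g) dg) dh = ∫ φ(h) dh · 1`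
    have hF : Continuous fun z : G × G => φ z.1 * ψ (z.1⁻¹ * z.2) := by fun_prop
    have hI : Integrable (Function.uncurry fun g h : G => φ h * ψ (h⁻¹ * g))
        ((haarProbability G).prod (haarProbability G)) := by
      obtain ⟨C, hC⟩ := isCompact_univ.exists_bound_of_continuousOn hF.continuousOn
      refine Integrable.mono' (integrable_const C) (by fun_prop) (ae_of_all _ fun z => ?_)
      exact hC (z.2, z.1) (Set.mem_univ _)
    rw [integral_integral_swap hI]
    have hinner : ∀ h : G, ∫ g, φ h * ψ (h⁻¹ * g) ∂(haarProbability G) = φ h := fun h => by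
      rw [integral_const_mul, integral_mul_left_eq_self (fun g => ψ g) h⁻¹,
        integral_haarConv_iterate hφ hφ1 k, mul_one]
    simp_rw [hinner]
    exact hφ1

/-! ### The ordered product of independent variables -/

omit [CompactSpace G] in
/-- The ordered product `w₀ w₁ ⋯ w_{k-1}` of the coordinates is a measurable function on `G^k`
(second countable `G`). [folklore] -/
theorem measurable_ofFn_prod [SecondCountableTopology G] :
    ∀ k : ℕ, Measurable fun w : Fin k → G => (List.ofFn w).prod
  | 0 => by simp only [List.ofFn_zero, List.prod_nil]; exact measurable_const
  | k + 1 => by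
    simp only [List.ofFn_succ, List.prod_cons]
    exact (measurable_pi_apply 0).mul
      ((measurable_ofFn_prod k).comp (measurable_pi_lambda _ fun i => measurable_pi_apply _))

/-- **The law of an ordered product of independent variables is the convolution power of their
common law** (Driver 1989, proof of Thm 7.4, the splicing formula on p. 600, and Def 7.1 of
`A_n`). For a continuous weight `φ` on a compact second countable group, a bounded measurable
`F : G → ℝ` and `k + 1` variables,
`∫_{G^{k+1}} F(w₀ w₁ ⋯ w_k) ∏ᵢ φ(wᵢ) dw = ∫_G F(g) φ^{⋆(k+1)}(g) dg`,
`φ^{⋆(k+1)} = (haarConv φ)^[k] φ`. Proof by induction on `k`: split off `w₀` (Fubini on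
`G × G^k`), apply the induction hypothesis to `F(w₀ ·)`, substitute `g ↦ w₀⁻¹ g` (left invariance)
and swap the two remaining integrals. [cite: DriverCMP1989, Thm 7.4 (proof, splicing formula) and Def 7.1] -/
theorem integral_pi_ofFn_prod_mul_prod [SecondCountableTopology G] {φ : G → ℝ} (hφ : Continuous φ) :
    ∀ (k : ℕ) {F : G → ℝ}, Measurable F → (∃ C, ∀ g, ‖F g‖ ≤ C) →
      ∫ w : Fin (k + 1) → G, F ((List.ofFn w).prod) * ∏ i, φ (w i)
          ∂(Measure.pi fun _ => haarProbability G) =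
        ∫ g, F g * ((haarConv φ)^[k] φ) g ∂(haarProbability G)
  | 0, F, hFm, hFb => by
    rw [← (measurePreserving_funUnique (haarProbability G) (Fin 1)).integral_comp']
    refine integral_congr_ae (ae_of_all _ fun w => ?_)
    simp [List.ofFn_succ, MeasurableEquiv.funUnique]
  | k + 1, F, hFm, hFb => by
    obtain ⟨C, hC⟩ := hFb
    set μ := haarProbability G with hμ
    set ψ := (haarConv φ)^[k] φ with hψdef
    have hψ : Continuous ψ := continuous_haarConv_iterate hφ k
    obtain ⟨Cφ, -, hCφ⟩ := exists_forall_abs_le_of_continuous hφ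
    obtain ⟨Cψ, -, hCψ⟩ := exists_forall_abs_le_of_continuous hψ
    have hC0 : 0 ≤ C := (norm_nonneg _).trans (hC 1)
    -- Step 1: split off the coordinate `0`: `G^{k+2} ≃ G × G^{k+1}`.
    have hsplit : ∫ w : Fin (k + 2) → G, F ((List.ofFn w).prod) * ∏ i, φ (w i)
          ∂(Measure.pi fun _ => μ) =
        ∫ z : G × (Fin (k + 1) → G), F (z.1 * (List.ofFn z.2).prod) * (φ z.1 * ∏ i, φ (z.2 i))
          ∂(μ.prod (Measure.pi fun _ => μ)) := by
      rw [← ((measurePreserving_piFinSuccAbove (fun _ : Fin (k + 2) => μ) 0).symm).integral_comp']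
      refine integral_congr_ae (ae_of_all _ fun z => ?_)
      simp only [MeasurableEquiv.piFinSuccAbove_symm_apply, Fin.insertNthEquiv,
        Equiv.coe_fn_mk, Fin.insertNth_zero', List.ofFn_succ, List.prod_cons, Fin.cons_zero,
        Fin.cons_succ, Fin.prod_univ_succ]
    -- Step 2: Fubini on `G × G^{k+1}` (bounded measurable integrand, finite measure).
    have hPm : Measurable fun w : Fin (k + 1) → G => (List.ofFn w).prod := measurable_ofFn_prod _
    have hint : Integrable (fun z : G × (Fin (k + 1) → G) =>
        F (z.1 * (List.ofFn z.2).prod) * (φ z.1 * ∏ i, φ (z.2 i))) (μ.prod (Measure.pi fun _ => μ)) := by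
      have hm : Measurable fun z : G × (Fin (k + 1) → G) =>
          F (z.1 * (List.ofFn z.2).prod) * (φ z.1 * ∏ i, φ (z.2 i)) :=
        (hFm.comp (measurable_fst.mul (hPm.comp measurable_snd))).mul
          ((hφ.measurable.comp measurable_fst).mul
            (Finset.measurable_prod _ fun i _ => hφ.measurable.comp ((measurable_pi_apply i).comp measurable_snd)))
      refine Integrable.mono' (integrable_const (C * (Cφ * Cφ ^ (k + 1)))) hm.aestronglyMeasurable
        (ae_of_all _ fun z => ?_)
      simp only [norm_mul, Real.norm_eq_abs, Finset.abs_prod]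
      refine mul_le_mul (hC _) (mul_le_mul (hCφ _) ?_ (by positivity) ((abs_nonneg _).trans (hCφ 1)))
        (by positivity) hC0
      calc ∏ i, |φ (z.2 i)| ≤ ∏ _i : Fin (k + 1), Cφ :=
            Finset.prod_le_prod (fun i _ => abs_nonneg _) fun i _ => hCφ _
        _ = Cφ ^ (k + 1) := by simp
    rw [hsplit, integral_prod _ hint]
    dsimp only
    -- Step 3: the inner integral by the induction hypothesis applied to `F(x ·)`.
    have hIH : ∀ x : G, ∫ w : Fin (k + 1) → G, F (x * (List.ofFn w).prod) * (φ x * ∏ i, φ (w i))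
          ∂(Measure.pi fun _ => μ) = φ x * ∫ g, F g * ψ (x⁻¹ * g) ∂μ := by
      intro x
      have h1 : ∫ w : Fin (k + 1) → G, F (x * (List.ofFn w).prod) * (φ x * ∏ i, φ (w i))
            ∂(Measure.pi fun _ => μ) =
          φ x * ∫ w : Fin (k + 1) → G, (fun g => F (x * g)) (List.ofFn w).prod * ∏ i, φ (w i)
            ∂(Measure.pi fun _ => μ) := by
        rw [← integral_const_mul]
        refine integral_congr_ae (ae_of_all _ fun w => ?_)
        ring
      rw [h1, integral_pi_ofFn_prod_mul_prod hφ k (F := fun g => F (x * g))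
        (hFm.comp (measurable_const_mul x)) ⟨C, fun g => hC _⟩]
      congr 1
      rw [← integral_mul_left_eq_self (fun g => F g * ψ (x⁻¹ * g)) x]
      simp only [inv_mul_cancel_left]
      rfl
    simp_rw [hIH]
    -- Step 4: swap the two integrals: `∫ φ(x) ∫ F(g) ψ(x⁻¹g) dg dx = ∫ F(g) (φ ⋆ ψ)(g) dg`.
    have hint2 : Integrable (Function.uncurry fun x g : G => φ x * (F g * ψ (x⁻¹ * g))) (μ.prod μ) := by
      have hm : Measurable (Function.uncurry fun x g : G => φ x * (F g * ψ (x⁻¹ * g))) :=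
        (hφ.measurable.comp measurable_fst).mul ((hFm.comp measurable_snd).mul
          (hψ.measurable.comp (measurable_fst.inv.mul measurable_snd)))
      refine Integrable.mono' (integrable_const (Cφ * (C * Cψ))) hm.aestronglyMeasurable
        (ae_of_all _ fun z => ?_)
      obtain ⟨x, g⟩ := z
      simp only [Function.uncurry_apply_pair, norm_mul, Real.norm_eq_abs]
      exact mul_le_mul (hCφ _) (mul_le_mul (by simpa using hC g) (hCψ _) (abs_nonneg _) hC0)
        (by positivity) ((abs_nonneg _).trans (hCφ 1))
    simp_rw [← integral_const_mul]
    rw [integral_integral_swap hint2]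
    refine integral_congr_ae (ae_of_all _ fun g => ?_)
    dsimp only
    rw [Function.iterate_succ_apply', ← hψdef, haarConv_apply, ← integral_const_mul]
    refine integral_congr_ae (ae_of_all _ fun x => ?_)
    ring

/-- The normalisation `∫_{G^{k}} ∏ᵢ φ(wᵢ) dw = (∫ φ)^k` (Fubini). [folklore] -/
theorem integral_pi_prod_eq_pow (φ : G → ℝ) (k : ℕ) :
    ∫ w : Fin k → G, ∏ i, φ (w i) ∂(Measure.pi fun _ => haarProbability G) =
      (∫ g, φ g ∂(haarProbability G)) ^ k := by
  rw [integral_fintype_prod_eq_pow, Fintype.card_fin]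

/-! ### Heat kernels: `p_t^{⋆(k+1)} = p_{(k+1)t}` -/

end Literature.MathematicalPhysics.QuantumFieldTheory

namespace Literature.MathematicalPhysics.QuantumLattice.IsGroupHeatKernel

open Literature.MathematicalPhysics.QuantumFieldTheory

variable {G : Type*} [Group G] [TopologicalSpace G] [IsTopologicalGroup G] [CompactSpace G]
  [MeasurableSpace G] [BorelSpace G] {p : ℝ → G → ℝ}

/-- **Chapman–Kolmogorov for convolution powers**: for a heat kernel `p` and `t > 0`,
`p_t^{⋆(k+1)} = (haarConv p_t)^[k] p_t = p_{(k+1)t}` (the `semigroup` field of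
`IsGroupHeatKernel` is literally `p_{s+t} = haarConv p_s p_t`). (Driver 1989 §4, Rem 4.13;
Lévy 2010 §4.1.) [cite: DriverCMP1989, §4 Rem 4.13] -/
theorem haarConv_iterate_eq (hp : IsGroupHeatKernel p) {t : ℝ} (ht : 0 < t) :
    ∀ k : ℕ, (haarConv (p t))^[k] (p t) = p ((k + 1) * t)
  | 0 => by simp
  | k + 1 => by
    rw [Function.iterate_succ_apply', haarConv_iterate_eq hp ht k]
    funext g
    have hkt : 0 < ((k : ℝ) + 1) * t := by positivity
    rw [haarConv_apply, ← hp.semigroup t (((k : ℝ) + 1) * t) ht hkt g]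
    congr 1
    push_cast
    ring

/-- **The ordered product of `k + 1` independent heat-kernel-distributed variables at time `t` is
heat-kernel distributed at time `(k+1) t`**: for bounded measurable `F`,
`∫_{G^{k+1}} F(w₀ ⋯ w_k) ∏ᵢ p_t(wᵢ) dw = ∫_G F p_{(k+1)t} = ym2LoopValue F p ((k+1) t)`. This is
the group-level content of "merging `k + 1` plaquettes of area `t` into one face of area
`(k+1) t`" in the planar heat-kernel lattice theory (Driver 1989 §3–4 and Thm 7.4/7.5 with the
Villain action `A = Q_t`, Def 8.3). [cite: DriverCMP1989, Thm 7.4 and Def 8.3] -/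
theorem integral_pi_ofFn_prod_mul_prod_heatKernel [SecondCountableTopology G]
    (hp : IsGroupHeatKernel p) {t : ℝ} (ht : 0 < t) (k : ℕ) {F : G → ℝ} (hFm : Measurable F)
    (hFb : ∃ C, ∀ g, ‖F g‖ ≤ C) :
    ∫ w : Fin (k + 1) → G, F ((List.ofFn w).prod) * ∏ i, p t (w i)
        ∂(Measure.pi fun _ => haarProbability G) =
      ym2LoopValue F p ((k + 1) * t) := by
  rw [integral_pi_ofFn_prod_mul_prod (hp.continuous ht) k hFm hFb, hp.haarConv_iterate_eq ht k]
  rfl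

/-- Normalisation of the heat-kernel product weight: `∫_{G^k} ∏ᵢ p_t(wᵢ) dw = 1`. [folklore] -/
theorem integral_pi_prod_heatKernel (hp : IsGroupHeatKernel p) {t : ℝ} (ht : 0 < t) (k : ℕ) :
    ∫ w : Fin k → G, ∏ i, p t (w i) ∂(Measure.pi fun _ => haarProbability G) = 1 := by
  rw [integral_pi_prod_eq_pow, hp.integral_eq_one t ht, one_pow]

end Literature.MathematicalPhysics.QuantumLattice.IsGroupHeatKernel
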